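import Summits.BirchSwinnertonDyer.Rank1Residual.X11b.KolyvaginShaOrderOfLeafInputs
import Summits.BirchSwinnertonDyer.Rank1Residual.X11b.KolyvaginLeafInputsDischarged
import Literature.NumberTheory.GaloisCohomology.PoitouTateNumberField
import HarnessLib

/-!
# Kolyvagin's ORDER bound `#Ш(E/K)[p^∞] ≤ p^{2M₀}` at ONE odd surjective prime `p` on the
# Kodaira–Néron sub-class (KN_p), modulo ONE cite-only input `hγ` and the Cassels–Tate inputs
# (the generic-prime ORDER END with `hPT`, `hrec`, `hCM`, `h53` DISCHARGED)

Cell `b2b-bsdres`, team x11b3 (N8/O2); seat x11b3-p2 GEN 52 (unit claimed D-0075 → BSD:K2/P4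
«Kolyvagin-in-kernel»; ladder row P4 «Kolyvagin #Ш(E/K)[p^∞] ≤ p^{2M₀} incl. p = 3 relative to
local-duality binders»).  Summit-side THEOREM-ONLY file (no definition, no named fact, no `sorry`);
`K : Type`; ONE generic odd prime `p` with `ρ̄_{E,p}` onto.

HONEST FRAMING (cell `b2b-bsdres`, run/shared/lean/b2b/bsd-rank1-residual/, verbatim in every
file): the goal of the cell is to DELETE the COMBINATION-SHAPED residual classes of the
Birch–Swinnerton-Dyer formula for ALL analytic-rank `≤ 1` elliptic curves over `ℚ` — "full BSD
formula for every rank `≤ 1` curve in class `C`" assembled STRICTLY from published theorems — so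
that the rank-`≤ 1` remainder becomes exactly the CONSTRUCTION-SHAPED classes, which are TYPED
(missing-input `Prop`s), NOT attempted.  This is not "finishing BSD".  Nothing here is booked; no
mark / label / count / tier moves.

WHAT THIS FILE DOES.  The generic-prime ORDER END of this seat's Kolyvagin telescope on (KN_p),
`KolyvaginOrder.card_sha_primary_le_at_of_leafInputs_of_poitouTate_of_kodairaNeron_of_localDuality`
(`KolyvaginShaOrderOfLeafInputs`, DEAL #32 P4 p391655: McCallum 1991 §1 Theorem (Kolyvagin) at
`p` — `Ш(E/K)[p^∞]` finite, killed by `p^{M₀}`, `#Ш(E/K)[p^∞] ≤ p^{2M₀}`, `ord_p # ≤ 2M₀`, for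
`p^{M₀} x₀ = y_K ∉ p^{M₀+1}E(K)`, `M₀ ≥ 1`), is CONDITIONAL on EXACTLY the five labelled cite-only
inputs {`hPT`, `hrec`, `hCM`, `h53`, `hγ`} AT `p` + `hN` + (KN_p) + the Cassels–Tate inputs at
level `p^{M₀}` (the tree's own open inputs of `exists_casselsTate_pairing_of_inputs`).  FOUR of the
five labels are now KERNEL THEOREMS of the tree (2026-08-27):
`hPT = GaloisCohomology.poitouTate_sum_localTatePairing_eq_zero_holds K`,
`hrec = heegnerPointOfConductor_one_galoisConj_holds N W K`, `hCM = KolyvaginLeaves.hCM_holds N W K p`,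
`h53 = KolyvaginLeaves.h53_holds hN p` (`X11b/KolyvaginLeafInputsDischarged`).  THIS FILE re-issues
the END with those labels SUPPLIED — every other binder (incl. the displayed Cassels–Tate inputs)
and the conclusion VERBATIM, proof = one application of the parent — so that Kolyvagin's order
bound at an odd surjective `p` on (KN_p) rests on EXACTLY ONE cite-only input AT `p`, `hγ` = Gross
1991 Prop. 3.7 (2) (the Eichler–Shimura congruence; not in the tree), plus the Cassels–Tate inputs.
Siblings: `KolyvaginShaAtPrimeDischarged` (finiteness / annihilator, no Cassels–Tate inputs) and the
`p = 3` class forms `Three/KolyvaginSha*Discharged`.  Nothing else is claimed; nothing booked.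

## What is proved (namespace `Summit.BirchSwinnertonDyer.Rank1Residual.X11b.KolyvaginDischarged`)

* `card_sha_primary_le_at_of_kodairaNeron_of_localDuality` — at `p` on (KN_p): finite ∧
  `p^{M₀}`-torsion ∧ `# ≤ p^{2M₀}` ∧ `ord_p # ≤ 2M₀`, modulo {`hγ`} + `hN` + (KN_p) + Cassels–Tate
  inputs.

## References

* [McCallumLMS1991] W. G. McCallum, *Kolyvagin's work on Shafarevich–Tate groups*, LMS LNS 153
  (1991), §1 Theorem p. 296, Lemma 5.1, Prop. 4.7, Lemma 5.3, Thm. 5.4, Cor. 5.6.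
* [GrossLMS1991] B. H. Gross, *Kolyvagin's work on modular elliptic curves*, same volume, Thm. 2.2
  (2), §3 Prop. 3.7 (2), Prop. 5.3, Prop. 6.2 (1).
* [MilneADT2006] J. S. Milne, *Arithmetic Duality Theorems*, 2nd ed., I §6 Prop. 6.9, Thm. 6.13(a).
* [SilvermanAEC2009] Thm. VII.6.1; [Darmon2004] Thm. 3.6, Thm. 3.7.

presearch: `lean search 'X11b.KolyvaginDischarged.card_sha'` → none; parent = the tree END named
above (this seat, GEN 41); dischargers = tree theorems of 2026-08-27 (see
`X11b/KolyvaginLeafInputsDischarged`); [corpus:book:editornd-l-functions-arithmetic chunk 216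
(Prop. 3.7)] for the remaining input; nothing minted.
-/

noncomputable section

namespace Summit.BirchSwinnertonDyer.Rank1Residual.X11b.KolyvaginDischarged

open scoped Classical
open WeierstrassCurve Field NumberField IsDedekindDomain Function
open Literature.NumberTheory.EllipticCurves Literature.NumberTheory.GaloisRepresentations
open Literature.NumberTheory.EllipticCurves.RingClassField
open Literature.NumberTheory.EllipticCurves.ModularForms
open Literature.NumberTheory.DiophantineGeometry Literature.NumberTheory.DiophantineGeometry.TateAlgorithm
open Literature.NumberTheory.GaloisCohomology
open Literature.NumberTheory.GaloisRepresentations.DiscreteGaloisModule (mu MuCarrier)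

-- `LocallyCompactSpace Γ_K` / `CharZero` of completions, as in the tree's Cassels–Tate files.
attribute [local instance] absoluteGaloisGroup_compactSpace charZero_placeCompletion

variable {K : Type} [Field K] [NumberField K] {N : ℕ} {W : WeierstrassCurve ℚ}

/-- **Kolyvagin's order bound at ONE odd surjective prime `p` on the Kodaira–Néron sub-class AT `p`:
`Ш(E/K)[p^∞]` finite ∧ `p^{M₀}`-torsion ∧ `#Ш(E/K)[p^∞] ≤ p^{2M₀}` ∧ `ord_p # ≤ 2M₀` — modulo ONE
cite-only input `hγ` AT `p` and the Cassels–Tate inputs** — for `p^{M₀} x₀ = y_K ∉ p^{M₀+1}E(K)`,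
`M₀ ≥ 1`.  The tree END
`KolyvaginOrder.card_sha_primary_le_at_of_leafInputs_of_poitouTate_of_kodairaNeron_of_localDuality`
(FIVE labels) with `hPT`, `hrec`, `hCM`, `h53` SUPPLIED by `poitouTate_sum_localTatePairing_eq_zero_holds K`,
`heegnerPointOfConductor_one_galoisConj_holds N W K`, `KolyvaginLeaves.hCM_holds N W K p`,
`KolyvaginLeaves.h53_holds hN p`; every other binder and the conclusion VERBATIM.  CONDITIONAL on
EXACTLY {`hγ`} AT `p` (Gross Prop. 3.7 (2); cite-only, NOT discharged) + `hN` + (KN_p) + the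
Cassels–Tate inputs; nothing booked; no mark / count / tier moves.
[cite: McCallumLMS1991, §1 Theorem (Kolyvagin), Cor. 5.6] [cite: GrossLMS1991, Thm. 2.2 (2), §3 Prop. 3.7 (2), Prop. 6.2 (1)]
[cite: MilneADT2006, Ch. I §6, Thm. 6.13(a)] [cite: SilvermanAEC2009, Thm. VII.6.1] -/
theorem card_sha_primary_le_at_of_kodairaNeron_of_localDuality [NeZero N]
    [W.IsGloballyMinimal] {p : ℕ} (hp : p.Prime) (hp2 : p ≠ 2)
    (hN : ∀ [W.IsElliptic], N = W.conductorNorm ℤ)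
    (hKNm : ∀ [W.IsElliptic] (v : HeightOneSpectrum (𝓞 K)),
      (W.baseChange K).HasMultiplicativeReductionAt v →
        ¬ p ∣ (W.baseChange K).ordMinimalDiscriminant v)
    (hKNa : ∀ [W.IsElliptic] (v : HeightOneSpectrum (𝓞 K)),
      (W.baseChange K).HasAdditiveReductionAt v → p ≠ 3 ∨
        ((W.baseChange K).kodairaSymbolAt v ≠ KodairaSymbol.IV ∧
          (W.baseChange K).kodairaSymbolAt v ≠ KodairaSymbol.IVstar))
    (hγ : ∀ [W.IsElliptic] (_hK : IsImaginaryQuadratic K) (_hH : SatisfiesHeegnerHypothesis N K)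
      (Dt : ModularParametrizationData W N) (β : ℤ) (ι : K →+* ℂ) {M : ℕ}
      (_hM : 1 ≤ M) {n : ℕ} (_hn : Squarefree n)
      (_hKol : ∀ q ∈ n.primeFactors, IsKolyvaginPrime N W K p q ∧ FrobEqFrobInfty W K (p ^ M) q)
      (d : (m : ℕ) → m ∣ n → KolyvaginHeegnerData Dt β ι m)
      (m : ℕ) (hm : m ∣ n) (ℓ : ℕ) (hℓ : ℓ ∈ m.primeFactors) [Fact ℓ.Prime]
      (hΔ : ¬ (ℓ : ℤ) ∣ minimalDiscriminantInt W) (φ₀ : absoluteGaloisGroup (ZMod ℓ)),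
      (∀ x : AlgebraicClosure (ZMod ℓ), φ₀ • x = x ^ ℓ) →
      ∀ (hle : ringClassField K ι (m / ℓ) ≤ ringClassField K ι m)
        (γ : ringClassField K ι m ≃ₐ[ℚ] ringClassField K ι m), γ ∈ ringClassGal ι m →
        geomReduction hΔ ((RatClosure.pointsEquiv (K := K) W).symm
            ((d m hm).toGeomPoints (pointGalHom W (ringClassField K ι m) γ (d m hm).y))) =
          φ₀ • geomReduction hΔ ((RatClosure.pointsEquiv (K := K) W).symm
            ((d m hm).toGeomPoints (pointGalHom W (ringClassField K ι m) γ
              (WeierstrassCurve.Affine.Point.map (W' := W)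
                ((RingClassField.inclusion ι hle).restrictScalars ℚ)
                (d (m / ℓ)
                  ((Nat.div_dvd_of_dvd (Nat.dvd_of_mem_primeFactors hℓ)).trans hm)).y))))) :
    ∀ [W.IsElliptic] (_hE : ¬ W.HasCM) (_hK : IsImaginaryQuadratic K)
      (_hD : NumberField.discr K ≠ -3 ∧ NumberField.discr K ≠ -4)
      (_hH : SatisfiesHeegnerHypothesis N K)
      {P : (W.baseChange K).toAffine.Point} (_hP : IsHeegnerPoint N W K P)
      (_hnt : ¬ IsOfFinAddOrder P) (_hρ : W.HasSurjectiveModNGaloisRep p)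
      {M₀ : ℕ} (_hM₀ : 1 ≤ M₀) [NeZero (p ^ M₀)] {c : K ≃ₐ[ℚ] K} (_hc : c ≠ 1) (_hcc : c * c = 1)
      {x₀ : (W.baseChange K).toAffine.Point} (_hx₀ : p ^ M₀ • x₀ = P)
      (_hmax : ∀ Q : (W.baseChange K).toAffine.Point, p ^ (M₀ + 1) • Q ≠ P)
      (e : geomTorsion (W.baseChange K) ((p ^ M₀ * p ^ M₀ : ℕ) : ℤ) →
        geomTorsion (W.baseChange K) ((p ^ M₀ * p ^ M₀ : ℕ) : ℤ) → AlgebraicClosure K)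
      (hμ : ∀ S T, e S T ^ (p ^ M₀ * p ^ M₀) = 1)
      (hadd₁ : ∀ S₁ S₂ T, e (S₁ + S₂) T = e S₁ T * e S₂ T)
      (hadd₂ : ∀ S T₁ T₂, e S (T₁ + T₂) = e S T₁ * e S T₂)
      (hgal : ∀ (σ : absoluteGaloisGroup K) (S T : geomTorsion (W.baseChange K) ((p ^ M₀ * p ^ M₀ : ℕ) : ℤ)),
        σ • e S T = e (σ • S) (σ • T))
      (halt : ∀ T, e T T = 1) (hnondeg : ∀ T, (∀ S, e S T = 1) → T = 0)
      (inv : LocalInvariants K (p ^ M₀ * p ^ M₀)) (hPT' : inv.SumInvLocalizationEqZero)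
      (hinv : ∀ v : HeightOneSpectrum (𝓞 K), Injective (inv (Sum.inr v)))
      (hH3 : ∀ x : galoisCohomology (mu K (p ^ M₀ * p ^ M₀)) 3,
        (∀ v : Place K, galoisCohomology.localization (mu K (p ^ M₀ * p ^ M₀)) v 3 x = 0) → x = 0)
      (hB : Literature.GroupTheory.FiniteAbelian.IsLevelPairing (p ^ M₀)
        (ctLevelPairing (W.baseChange K) (p ^ M₀) e hμ hadd₁ hadd₂ hgal inv halt hPT' hH3
          (localTerm_finite_support (W := W.baseChange K) (m := p ^ M₀) (e := e) (hμ := hμ)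
            (hadd₁ := hadd₁) (hadd₂ := hadd₂) (hgal := hgal) halt inv)))
      (hPτ : ∀ z ∈ selmerGroup (W.baseChange K) ((p ^ M₀ * p ^ M₀ : ℕ) : ℤ),
        ∀ t ∈ selmerGroup (W.baseChange K) ((p ^ M₀ * p ^ M₀ : ℕ) : ℤ),
        ctGeneralFun (W.baseChange K) (p ^ M₀) e hμ hadd₁ hadd₂ hgal inv
            (torsionH1ToH1 (W.baseChange K) _ (conjAct W c _ z))
            (torsionH1ToH1 (W.baseChange K) _ (conjAct W c _ t)) =
          ctGeneralFun (W.baseChange K) (p ^ M₀) e hμ hadd₁ hadd₂ hgal inv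
            (torsionH1ToH1 (W.baseChange K) _ z) (torsionH1ToH1 (W.baseChange K) _ t)),
      Finite (AddCommGroup.primaryComponent (W.baseChange K).sha p) ∧
      (∀ c ∈ AddCommGroup.primaryComponent (W.baseChange K).sha p, p ^ M₀ • c = 0) ∧
      Nat.card (AddCommGroup.primaryComponent (W.baseChange K).sha p) ≤ p ^ (2 * M₀) ∧
      padicValNat p (Nat.card (AddCommGroup.primaryComponent (W.baseChange K).sha p)) ≤ 2 * M₀ :=
  KolyvaginOrder.card_sha_primary_le_at_of_leafInputs_of_poitouTate_of_kodairaNeron_of_localDuality hp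
    hp2 (poitouTate_sum_localTatePairing_eq_zero_holds K) hN
    (heegnerPointOfConductor_one_galoisConj_holds N W K) (KolyvaginLeaves.hCM_holds N W K p)
    (@fun _ ↦ KolyvaginLeaves.h53_holds hN p) hKNm hKNa hγ

end Summit.BirchSwinnertonDyer.Rank1Residual.X11b.KolyvaginDischarged

end
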